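import Literature.Computability.AlgebraicComplexity.MoreAsymmetricCleanup
import Literature.Computability.AlgebraicComplexity.AsymmetricCleanupGeneral
import HarnessLib

/-!
# More asymmetric hashing for an arbitrary family of level triples with bounded `X`-degree
(Alman–Duan–Vassilevska Williams–Xu–Xu–Zhou 2025, §6.2, Lemma 6.7 "Properties of more asymmetric
hashing" at the constituent stage; = Lemma 5.5 for a general family) — proved

Topic `Literature/Computability/AlgebraicComplexity`.  §6.2 of Alman–Duan–Vassilevska Williams–Xu–Xu–
Zhou, *More asymmetry yields faster matrix multiplication* (SODA 2025, arXiv:2404.16349) hashes the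
level-`(ℓ−1)` block triples remaining inside a level-`ℓ` interface tensor with the hash family of §5.2 and
cleans the buckets in the `X`-dimension only ("If there are two remaining level-`(ℓ−1)` triples
`X_I Y_J Z_K` and `X_I Y_{J'} Z_{K'}` sharing the same `X`-block that are hashed to the same hash value
`b ∈ B`, we zero out `X_I`. Then for every level-`(ℓ−1)` block `X_I`, we check whether the unique triple
containing it is consistent with `{α_t}`; if not, we zero out `X_I` … We call the tensor after this step
`𝒯_hash`"), under `M₀ ≥ 8 · numtriple/numxblock`; **Lemma 6.7** states the bucket probabilities
`1/M²`, `1/M`, the survival probability `≥ 3/4` and `E[#triples of 𝒯_hash] ≥ numalpha · M₀^{−1−o(1)}`.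
The tree's §5 versions (`MoreAsymmetricCleanup.lean`, Lemma 5.5) are stated for the family of triples
with prescribed marginal types, whose `X`-degree is `numtriple/numxblock` by symmetry; in §6 the family
(level-`(ℓ−1)` triples with prescribed per-term pair types) and its symmetry group differ, so — exactly as
`AsymmetricCleanupGeneral.lean` does for VXXZ's two-dimensional cleanup (Claims 6.6–6.8) — this file
PROVES the lemma once and for all for an ARBITRARY finite family `𝒯` of level triples
(`IsLevelFamily`) in terms of its `X`-degree:

* `advxxz2025_lemma67_survival` — **Lemma 6.7 (2)** (indeed `7/8`): if `8 · deg_X(T) ≤ M`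
  (`deg_X(T) = #{T' ∈ 𝒯 | T'.1 = T.1}`), `M` an odd prime `> P`, `n ≥ 1`, then
  `7 M^n ≤ 8 · #{ω | XSurvives 𝒯 ω T b}`; `advxxz2025_lemma67_survival_three_quarters` — the printed `3/4`
  (item (1) is `IsLevelFamily.card_seeds_inBucket(_shareX)` of `AsymmetricCleanupGeneral.lean`);
* `advxxz2025_lemma67_expectation`, `advxxz2025_lemma67_exists` — **Lemma 6.7 (3)** summed over
  `𝒯α ⊆ 𝒯` and `b ∈ B`, and the existence of a seed attaining the expectation;
* `IsLevelFamily.xPresentTriples_eq_filter_xSurvives` — the triples of `𝒯_hash`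
  (`xPresentTriples`, generic in `𝒯`) are the `{α_t}`-consistent `X`-survivors in some bucket of a
  3-AP-free `B`; `IsLevelFamily.exists_seed_card_xPresentTriples` — some seed gives
  `7 |B| |𝒯α| ≤ 8 M² · |𝒯_hash|`.

Everything is proved; no definitions; no named facts.

## References

* J. Alman, R. Duan, V. Vassilevska Williams, Y. Xu, Z. Xu, R. Zhou, *More asymmetry yields faster
  matrix multiplication*, SODA 2025, arXiv:2404.16349 (held: `paper:arxiv-2404.16349`, chunk p0023):
  §6.2 (the hashing, `M₀ ≥ 8 numtriple/numxblock`, the definition of `𝒯_hash`, Lemma 6.7).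
  [AlmanDuanVassilevskaWilliamsXuXuZhou2025]
* V. Vassilevska Williams, Y. Xu, Z. Xu, R. Zhou, *New bounds for matrix multiplication: from alpha
  to omega*, SODA 2024, arXiv:2307.07970, §6.2, Claims 6.6–6.8 (the two-dimensional originals).
  [VassilevskaWilliamsXuXuZhou2024]
-/

open scoped BigOperators
open Finset

namespace Literature.Computability.AlgebraicComplexity

/-! ## Lemma 6.7 (2)–(3): `X`-survival for a level family -/

section Survival

variable {M n P : ℕ} [Fact M.Prime]
variable {𝒯 : Finset ((Fin n → Fin (P + 1)) × (Fin n → Fin (P + 1)) × (Fin n → Fin (P + 1)))}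

/-- **ADVXXZ Lemma 6.7 (2)** (survival probability, counting form, sharp constant, for an arbitrary family
of level triples).  If `M` is an odd prime with `P < M`, `n ≥ 1`, and the triple `T ∈ 𝒯` has
`8 · deg_X(T) ≤ M` (`deg_X(T) = #{T' ∈ 𝒯 | T'.1 = T.1}`; the requirement `M ≥ M₀ ≥ 8 · numtriple/numxblock`
once the degrees are uniform), then at least `7/8` of the `M^n` seeds putting `T` into bucket `b` let it
`X`-survive: `7 M^n ≤ 8 · #{ω | XSurvives 𝒯 ω T b}`. [cite: AlmanDuanVassilevskaWilliamsXuXuZhou2025, Lemma 6.7 (2)] -/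
theorem advxxz2025_lemma67_survival (h𝒯 : IsLevelFamily P 𝒯) (hM : M ≠ 2) (hPM : P < M) (hn : 0 < n)
    {T : (Fin n → Fin (P + 1)) × (Fin n → Fin (P + 1)) × (Fin n → Fin (P + 1))} (hT : T ∈ 𝒯)
    (hdegX : 8 * (𝒯.filter fun T' => T'.1 = T.1).card ≤ M) (b : ZMod M) :
    7 * M ^ n ≤ 8 * (univ.filter fun ω : VxxzSeed M n => XSurvives 𝒯 ω T b).card := by
  classical
  set S := univ.filter fun ω : VxxzSeed M n => XSurvives 𝒯 ω T b with hS
  set CX := univ.filter fun ω : VxxzSeed M n =>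
    InBucket P ω T b ∧ ∃ T' ∈ 𝒯, T' ≠ T ∧ T'.1 = T.1 ∧ InBucket P ω T' b with hCX
  have hcover : (univ.filter fun ω : VxxzSeed M n => InBucket P ω T b) ⊆ S ∪ CX := by
    intro ω hω
    rw [mem_filter] at hω
    rw [mem_union, hS, hCX, mem_filter, mem_filter]
    by_cases hx : ∃ T' ∈ 𝒯, T' ≠ T ∧ T'.1 = T.1 ∧ InBucket P ω T' b
    · exact Or.inr ⟨mem_univ _, hω.2, hx⟩
    exact Or.inl ⟨mem_univ _, hω.2, fun T' hT' hne h1 hb => hx ⟨T', hT', hne, h1, hb⟩⟩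
  have hbucket : (univ.filter fun ω : VxxzSeed M n => InBucket P ω T b).card = M ^ n :=
    h𝒯.card_seeds_inBucket hM hT b
  have hCXle : CX.card ≤ ((𝒯.filter fun T' => T'.1 = T.1).card - 1) * M ^ (n - 1) := by
    have hsub : CX ⊆ ((𝒯.filter fun T' => T'.1 = T.1).erase T).biUnion fun T' =>
        univ.filter fun ω : VxxzSeed M n => InBucket P ω T b ∧ InBucket P ω T' b := by
      intro ω hω
      rw [hCX, mem_filter] at hω
      obtain ⟨-, hb, T', hT', hne, h1, hb'⟩ := hω
      rw [mem_biUnion]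
      exact ⟨T', mem_erase.2 ⟨hne, mem_filter.2 ⟨hT', h1⟩⟩, mem_filter.2 ⟨mem_univ _, hb, hb'⟩⟩
    refine (card_le_card hsub).trans (card_biUnion_le.trans ?_)
    have hTmem : T ∈ 𝒯.filter (fun T' => T'.1 = T.1) := mem_filter.2 ⟨hT, rfl⟩
    rw [← card_erase_of_mem hTmem, ← smul_eq_mul, ← sum_const]
    refine sum_le_sum fun T' hT' => ?_
    obtain ⟨hne, hT'⟩ := mem_erase.1 hT'
    obtain ⟨hT'𝒯, h1⟩ := mem_filter.1 hT'
    exact (h𝒯.card_seeds_inBucket_shareX hM hPM hn hT hT'𝒯 hne h1 b).le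
  have hpow : M ^ (n - 1) * M = M ^ n := by
    rw [← pow_succ]; congr 1; omega
  have hCX8 : 8 * CX.card ≤ M ^ n := by
    calc 8 * CX.card ≤ 8 * (((𝒯.filter fun T' => T'.1 = T.1).card - 1) * M ^ (n - 1)) :=
          Nat.mul_le_mul_left _ hCXle
      _ ≤ 8 * ((𝒯.filter fun T' => T'.1 = T.1).card * M ^ (n - 1)) :=
          Nat.mul_le_mul_left _ (Nat.mul_le_mul_right _ (Nat.sub_le _ _))
      _ = 8 * (𝒯.filter fun T' => T'.1 = T.1).card * M ^ (n - 1) := by ring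
      _ ≤ M * M ^ (n - 1) := Nat.mul_le_mul_right _ hdegX
      _ = M ^ n := by rw [mul_comm, hpow]
  have hle : M ^ n ≤ S.card + CX.card := by
    rw [← hbucket]
    exact (card_le_card hcover).trans (card_union_le _ _)
  omega

/-- **Lemma 6.7 (2) as printed**: `3 M^n ≤ 4 · #{ω | XSurvives 𝒯 ω T b}`. [cite: AlmanDuanVassilevskaWilliamsXuXuZhou2025, Lemma 6.7 (2)] -/
theorem advxxz2025_lemma67_survival_three_quarters (h𝒯 : IsLevelFamily P 𝒯) (hM : M ≠ 2) (hPM : P < M) (hn : 0 < n)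
    {T : (Fin n → Fin (P + 1)) × (Fin n → Fin (P + 1)) × (Fin n → Fin (P + 1))} (hT : T ∈ 𝒯)
    (hdegX : 8 * (𝒯.filter fun T' => T'.1 = T.1).card ≤ M) (b : ZMod M) :
    3 * M ^ n ≤ 4 * (univ.filter fun ω : VxxzSeed M n => XSurvives 𝒯 ω T b).card := by
  have := advxxz2025_lemma67_survival h𝒯 hM hPM hn hT hdegX b
  omega

/-- **ADVXXZ Lemma 6.7 (3)** (expected number of triples of `𝒯_hash`, counting form): for `𝒯α ⊆ 𝒯` (the
triples consistent with `{α_t}`) all of whose members obey the degree bound, and the buckets `b ∈ B`,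
`7 |B| |𝒯α| M^n ≤ 8 ∑_ω #{(b,T) ∈ B × 𝒯α | XSurvives 𝒯 ω T b}` — the expectation over the `M^{n+2}` seeds is
`≥ (7/8) |B| |𝒯α| / M² = numalpha · M₀^{−1−o(1)}`. [cite: AlmanDuanVassilevskaWilliamsXuXuZhou2025, Lemma 6.7 (3)] -/
theorem advxxz2025_lemma67_expectation (h𝒯 : IsLevelFamily P 𝒯) (hM : M ≠ 2) (hPM : P < M) (hn : 0 < n)
    {𝒯α : Finset ((Fin n → Fin (P + 1)) × (Fin n → Fin (P + 1)) × (Fin n → Fin (P + 1)))} (h𝒯α : 𝒯α ⊆ 𝒯)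
    (hdegX : ∀ T ∈ 𝒯α, 8 * (𝒯.filter fun T' => T'.1 = T.1).card ≤ M) (B : Finset (ZMod M)) :
    7 * (B.card * 𝒯α.card * M ^ n) ≤ 8 * ∑ ω : VxxzSeed M n,
      ((B ×ˢ 𝒯α).filter fun bT => XSurvives 𝒯 ω bT.2 bT.1).card := by
  classical
  have hswap : ∑ ω : VxxzSeed M n, ((B ×ˢ 𝒯α).filter fun bT => XSurvives 𝒯 ω bT.2 bT.1).card =
      ∑ bT ∈ B ×ˢ 𝒯α, (univ.filter fun ω : VxxzSeed M n => XSurvives 𝒯 ω bT.2 bT.1).card := by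
    simp only [card_filter]
    rw [sum_comm]
  rw [hswap, mul_sum]
  calc 7 * (B.card * 𝒯α.card * M ^ n) = ∑ _bT ∈ B ×ˢ 𝒯α, 7 * M ^ n := by
        rw [sum_const, card_product, smul_eq_mul]; ring
    _ ≤ ∑ bT ∈ B ×ˢ 𝒯α, 8 * (univ.filter fun ω : VxxzSeed M n => XSurvives 𝒯 ω bT.2 bT.1).card :=
        sum_le_sum fun bT hbT => advxxz2025_lemma67_survival h𝒯 hM hPM hn (h𝒯α (mem_product.1 hbT).2)
          (hdegX _ (mem_product.1 hbT).2) bT.1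

/-- **Lemma 6.7 (3), existence of a good seed**: `∃ ω, 7 |B| |𝒯α| ≤ 8 M² · #{T ∈ 𝒯α | T X-survives in some b ∈ B}`.
[cite: AlmanDuanVassilevskaWilliamsXuXuZhou2025, Lemma 6.7 (3)] -/
theorem advxxz2025_lemma67_exists (h𝒯 : IsLevelFamily P 𝒯) (hM : M ≠ 2) (hPM : P < M) (hn : 0 < n)
    {𝒯α : Finset ((Fin n → Fin (P + 1)) × (Fin n → Fin (P + 1)) × (Fin n → Fin (P + 1)))} (h𝒯α : 𝒯α ⊆ 𝒯)
    (hdegX : ∀ T ∈ 𝒯α, 8 * (𝒯.filter fun T' => T'.1 = T.1).card ≤ M) (B : Finset (ZMod M)) :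
    ∃ ω : VxxzSeed M n, 7 * (B.card * 𝒯α.card) ≤ 8 * M ^ 2 *
      (𝒯α.filter fun T => ∃ b ∈ B, XSurvives 𝒯 ω T b).card := by
  classical
  have hsum := advxxz2025_lemma67_expectation h𝒯 hM hPM hn h𝒯α hdegX B
  simp only [card_filter_product_xSurvives_eq] at hsum
  by_contra hcon
  simp only [not_exists, not_le] at hcon
  have hlt : ∑ ω : VxxzSeed M n, 8 * M ^ 2 * (𝒯α.filter fun T => ∃ b ∈ B, XSurvives 𝒯 ω T b).card <
      ∑ _ω : VxxzSeed M n, 7 * (B.card * 𝒯α.card) :=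
    sum_lt_sum_of_nonempty univ_nonempty fun ω _ => hcon ω
  rw [sum_const, card_univ, card_vxxzSeed, smul_eq_mul, ← mul_sum] at hlt
  have : M ^ (n + 2) * (7 * (B.card * 𝒯α.card)) ≤ 8 * M ^ 2 *
      ∑ ω : VxxzSeed M n, (𝒯α.filter fun T => ∃ b ∈ B, XSurvives 𝒯 ω T b).card := by
    calc M ^ (n + 2) * (7 * (B.card * 𝒯α.card)) = M ^ 2 * (7 * (B.card * 𝒯α.card * M ^ n)) := by ring
      _ ≤ M ^ 2 * (8 * ∑ ω : VxxzSeed M n, (𝒯α.filter fun T => ∃ b ∈ B, XSurvives 𝒯 ω T b).card) :=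
          Nat.mul_le_mul_left _ hsum
      _ = _ := by ring
  exact absurd (lt_of_le_of_lt this hlt) (lt_irrefl _)

end Survival

/-! ## The triples of `𝒯_hash` of a level family -/

section Present

variable {M n P : ℕ} [Fact M.Prime]
variable {𝒯 : Finset ((Fin n → Fin (P + 1)) × (Fin n → Fin (P + 1)) × (Fin n → Fin (P + 1)))}

/-- **The triples of `𝒯_hash` of a level family are the `{α_t}`-consistent `X`-survivors in the buckets of
`B`** (3-AP-free `B`, odd prime `M`). [cite: AlmanDuanVassilevskaWilliamsXuXuZhou2025, §6.2 (definition of 𝒯_hash) and Lemma 6.7] -/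
theorem IsLevelFamily.xPresentTriples_eq_filter_xSurvives (h𝒯 : IsLevelFamily P 𝒯) (hM : M ≠ 2)
    {𝒯α : Finset ((Fin n → Fin (P + 1)) × (Fin n → Fin (P + 1)) × (Fin n → Fin (P + 1)))} (h𝒯α : 𝒯α ⊆ 𝒯)
    (ω : VxxzSeed M n) {B : Finset (ZMod M)} (hB : ThreeAPFree (B : Set (ZMod M))) :
    xPresentTriples P 𝒯 𝒯α ω B = 𝒯α.filter fun T => ∃ b ∈ B, XSurvives 𝒯 ω T b := by
  classical
  ext T
  rw [mem_xPresentTriples, mem_filter, mem_keptX, mem_xKeptY, mem_keptZ]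
  constructor
  · rintro ⟨hT, ⟨-, hXB, T₁, hT₁α, hT₁p, hT₁I, huX⟩, ⟨-, hYB⟩, -, hZB⟩
    have hTp : T ∈ hashPresent P 𝒯 ω B := mem_hashPresent.2 ⟨hT, hXB, hYB, hZB⟩
    have hT1 : T = T₁ := huX T hTp rfl
    refine ⟨hT1 ▸ hT₁α, vxxzHashX ω (seqVal T.1), hXB, h𝒯.inBucket_of_mem_hashPresent hM hB hTp, ?_⟩
    intro T' hT' hne h1 hb
    exact hne ((huX T' (mem_hashPresent_of_inBucket hXB hT' hb) h1).trans hT1.symm)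
  · rintro ⟨hTα, b, hb, hin, huX⟩
    have hT : T ∈ 𝒯 := h𝒯α hTα
    have hTp : T ∈ hashPresent P 𝒯 ω B := mem_hashPresent_of_inBucket hb hT hin
    obtain ⟨hXb, hYb, hZb⟩ := hin
    have hbX : b = vxxzHashX ω (seqVal T.1) := hXb.symm
    refine ⟨hT, ⟨⟨T, hT, rfl⟩, by rw [hXb]; exact hb, T, hTα, hTp, rfl, fun T' hT'p h1 => ?_⟩,
      ⟨⟨T, hT, rfl⟩, by rw [hYb]; exact hb⟩, ⟨T, hT, rfl⟩, by rw [hZb]; exact hb⟩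
    by_contra hne
    have hin' := h𝒯.inBucket_of_mem_hashPresent hM hB hT'p
    rw [h1, ← hbX] at hin'
    exact huX T' (mem_hashPresent.1 hT'p).1 hne h1 hin'

/-- Hence Lemma 6.7 (3) counts the triples of `𝒯_hash`: under the degree bound on `𝒯α`, some seed gives
`7 |B| |𝒯α| ≤ 8 M² · |𝒯_hash|`. [cite: AlmanDuanVassilevskaWilliamsXuXuZhou2025, Lemma 6.7 (3)] -/
theorem IsLevelFamily.exists_seed_card_xPresentTriples (h𝒯 : IsLevelFamily P 𝒯) (hM : M ≠ 2) (hPM : P < M) (hn : 0 < n)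
    {𝒯α : Finset ((Fin n → Fin (P + 1)) × (Fin n → Fin (P + 1)) × (Fin n → Fin (P + 1)))} (h𝒯α : 𝒯α ⊆ 𝒯)
    (hdegX : ∀ T ∈ 𝒯α, 8 * (𝒯.filter fun T' => T'.1 = T.1).card ≤ M) {B : Finset (ZMod M)}
    (hB : ThreeAPFree (B : Set (ZMod M))) :
    ∃ ω : VxxzSeed M n, 7 * (B.card * 𝒯α.card) ≤ 8 * M ^ 2 * (xPresentTriples P 𝒯 𝒯α ω B).card := by
  obtain ⟨ω, hω⟩ := advxxz2025_lemma67_exists h𝒯 hM hPM hn h𝒯α hdegX B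
  exact ⟨ω, by rwa [h𝒯.xPresentTriples_eq_filter_xSurvives hM h𝒯α ω hB]⟩

end Present

end Literature.Computability.AlgebraicComplexity
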